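import Mathlib
import Summits.Schanuel.Schanuel.Theorems.KhovanskiiApproxType.Negative.LoadBearing
import HarnessLib

/-!
# Route `DiophantineDichotomy`, crux `KhovanskiiApproxTypeEv` (stmt-Schanuel-14972), line `lambert-liouville-kill`:
# stub `stub_syncDiaz` — the SYNCHRONISED Diaz approximant of `e`

Crux `Summit.Schanuel.Schanuel.Theses.DiophantineDichotomy.KhovanskiiApproxTypeEv` (item stmt-Schanuel-14972),
certificate line `lambert-liouville-kill` (skeleton `Cruxes/KhovanskiiApproxTypeEv/Lines/lambert_liouville_kill.lean`,
lead `prover-line-stmt-Schanuel-14972-a1-0`), registered stub `stub_syncDiaz` (LOAD-BEARING stub of the rank-2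
certificate `notLiouville_lambert_of_ev : KhovanskiiApproxTypeEv → no Lambert number W(1/k) is Liouville`;
landed `--supports stmt-Schanuel-14972`).

Statement: GIVEN a per-degree polynomial measure of algebraic approximation of `e` (the statement of
`stub_expOneDegreeMeasure`: at degree `≤ N`, `|e − α| ≥ c₀(N) H(α)^{−κ(N)}`), every budget `n ≥ 50` admits a
window exponent `M₀ > 0` and a threshold `q₁` such that EVERY scale `q ≥ q₁` carries an algebraic `α` with a
non-zero annihilating `P ∈ ℤ[X]`, `deg P ≤ n`, naive height `≤ H`, `q ≤ H ≤ q^{M₀}`, and `|e − α| ≤ H^{−n/200}`.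

Proof (Diaz 1997 = Bugeaud 2004 Thm 8.11, PROVED in tree as
`Literature.NumberTheory.DiophantineApproximation.Bugeaud2004_thm_8_11_holds`): at `ξ = e`, degree `n` and
`M := exp L`, `L := (κ log q + |log c₀|)/0.006 + log(n+1) + 100 log(4+|e|)`, Diaz gives `α` and an irreducible
`P` with `deg P ≤ n`, `M(P) ≤ M`, `|e − α| ≤ exp(−0.006(n log M(P) + deg P · log M)) ≤ M^{−0.006}`.  With
`H := H(P) ≤ 2^{deg P} M(P)` (`natHeight_le`) the measure `c₀ H^{−κ} ≤ |e − α| ≤ M^{−0.006}` forces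
`κ log H ≥ κ log q`, i.e. `H ≥ q`; `log H ≤ n log 2 + L ≤ M₀ log q`; and for `H ≥ 2^{6(n+1)}` (guaranteed by
`q ≥ q₁ := 2^{6(n+1)}`) the quality exponent `0.006(n log M(P) + deg P log M) ≥ 0.006(n+1)(log H − n log 2)`
dominates `(n/200) log H`.
-/

noncomputable section

-- `Summit.Schanuel.Schanuel.…` is the mandated summit/sub-problem namespace (single-conjunct summit), hence:
set_option linter.dupNamespace false

namespace Summit.Schanuel.Schanuel.Cruxes.KhovanskiiApproxTypeEv.LambertLiouvilleKill

open Polynomial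
open Summit.Schanuel.Schanuel.Cruxes.KhovanskiiApproxType.Negative
  (natHeight abs_coeff_le_natHeight one_le_natHeight natHeight_le)
open Literature.NumberTheory.DiophantineApproximation (Bugeaud2004_thm_8_11_holds
  one_le_mahlerMeasure_map)

/-- The final exponent comparison of the synchronised Diaz approximant: if `log H ≥ 6(n+1) log 2`,
`log M(P) ≥ log H − n log 2`, `log M ≥ log M(P)`, `log M ≥ 0` and `deg P ≥ 1`, then
`(n/200) log H ≤ 0.006 (n log M(P) + deg P · log M)`. [folklore] -/
theorem syncDiaz_exponent (n : ℕ) (lH lMP lM dP : ℝ) (hH : 6 * ((n : ℝ) + 1) * Real.log 2 ≤ lH)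
    (hMP : lH - n * Real.log 2 ≤ lMP) (hM : lMP ≤ lM) (hM0 : 0 ≤ lM) (hdP : 1 ≤ dP) :
    (n : ℝ) / 200 * lH ≤ 6 / 1000 * (n * lMP + dP * lM) := by
  have hn : (0 : ℝ) ≤ n := Nat.cast_nonneg n
  have hlog2 : 0 < Real.log 2 := Real.log_pos one_lt_two
  have h1 : (n : ℝ) * (lH - n * Real.log 2) ≤ n * lMP := mul_le_mul_of_nonneg_left hMP hn
  have h2 : lM ≤ dP * lM := le_mul_of_one_le_left hM0 hdP
  have h3 : lH - n * Real.log 2 ≤ lM := hMP.trans hM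
  -- `(n + 6) · 6 (n + 1) log 2 ≤ (n + 6) · lH`
  have h4 : ((n : ℝ) + 6) * (6 * ((n : ℝ) + 1) * Real.log 2) ≤ ((n : ℝ) + 6) * lH :=
    mul_le_mul_of_nonneg_left hH (by linarith)
  nlinarith [h1, h2, h3, h4, hlog2, hn]

/-- **STUB 3 (the SYNCHRONISED Diaz approximant of `e`).**  Given a per-degree polynomial measure of
algebraic approximation of `e` (`|e − α| ≥ c₀(N) H^{−κ(N)}` for roots `α` of non-zero integer polynomials of
degree `≤ N` and height `≤ H`): for every `n ≥ 50` there are `M₀ > 0` and `q₁` such that every scale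
`q ≥ q₁` carries an algebraic `α` with a non-zero annihilating `P ∈ ℤ[X]` of degree `≤ n` and height `≤ H`,
`q ≤ H ≤ q^{M₀}`, and `|e − α| ≤ H^{−n/200}`.  Proof: Bugeaud 2004 Thm 8.11 (Diaz 1997, PROVED in tree) at
`ξ = e` with `M := exp((κ log q + |log c₀|)/0.006 + log(n+1) + 100 log(4 + |e|))`; the measure pins the naive
height `H = H(P) ≤ 2^{deg P} M(P)` of the approximant into `[q, q^{M₀}]`, and for `H ≥ 2^{6(n+1)}` the quality
`exp(−0.006(n log M(P) + deg P log M))` is `≤ H^{−n/200}` (`syncDiaz_exponent`). [cite: Bugeaud2004, Thm 8.11] -/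
theorem stub_syncDiaz :
    (∀ N : ℕ, 1 ≤ N → ∃ κ c₀ : ℝ, 0 < κ ∧ 0 < c₀ ∧ ∀ (α : ℂ) (P : ℤ[X]) (H : ℕ), P ≠ 0 →
      Polynomial.aeval α P = 0 → P.natDegree ≤ N → 1 ≤ H → (∀ j, |P.coeff j| ≤ (H : ℤ)) →
      c₀ * (H : ℝ) ^ (-κ) ≤ ‖Complex.exp 1 - α‖) →
    ∀ n : ℕ, 50 ≤ n → ∃ M₀ : ℝ, 0 < M₀ ∧ ∃ q₁ : ℕ, ∀ q : ℕ, q₁ ≤ q →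
      ∃ (α : ℂ) (P : ℤ[X]) (H : ℕ), P ≠ 0 ∧ Polynomial.aeval α P = 0 ∧ P.natDegree ≤ n ∧
        (∀ j, |P.coeff j| ≤ (H : ℤ)) ∧ q ≤ H ∧ (H : ℝ) ≤ (q : ℝ) ^ M₀ ∧
        ‖Complex.exp 1 - α‖ ≤ (H : ℝ) ^ (-((n : ℝ) / 200)) := by
  intro hmeas n hn50
  have hn1 : 1 ≤ n := le_trans (by norm_num) hn50
  have hnR : (1 : ℝ) ≤ n := by exact_mod_cast hn1
  have hn0 : (0 : ℝ) ≤ n := Nat.cast_nonneg n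
  obtain ⟨κ, c₀, hκ, hc₀, hM⟩ := hmeas n hn1
  set ξ : ℂ := Complex.exp 1 with hξ
  have hlog2 : 0 < Real.log 2 := Real.log_pos one_lt_two
  -- constants: `A := log(n+1) + 100 log(4 + ‖e‖) ≥ 0`, window exponent `M₀`
  set A : ℝ := Real.log ((n : ℝ) + 1) + 100 * Real.log (4 + ‖ξ‖) with hA
  have hA0 : 0 ≤ A := by
    have h1 : 0 ≤ Real.log ((n : ℝ) + 1) := Real.log_nonneg (by linarith)
    have h2 : 0 ≤ Real.log (4 + ‖ξ‖) := Real.log_nonneg (by linarith [norm_nonneg ξ])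
    positivity
  set M₀ : ℝ := n * Real.log 2 + (κ + |Real.log c₀|) / (6 / 1000) + A + 1 with hM₀
  have hM₀pos : 0 < M₀ := by
    have : 0 ≤ (κ + |Real.log c₀|) / (6 / 1000) := by positivity
    have : 0 ≤ (n : ℝ) * Real.log 2 := by positivity
    linarith
  refine ⟨M₀, hM₀pos, 2 ^ (6 * (n + 1)), fun q hq => ?_⟩
  -- the scale `q ≥ 2^{6(n+1)}`: `log q ≥ 6(n+1) log 2 ≥ 1`
  have hq2 : (2 : ℝ) ^ (6 * (n + 1)) ≤ q := by exact_mod_cast hq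
  have hqpos : (0 : ℝ) < q := lt_of_lt_of_le (by positivity) hq2
  have hlogq : 6 * ((n : ℝ) + 1) * Real.log 2 ≤ Real.log q := by
    have h := Real.log_le_log (by positivity) hq2
    rw [Real.log_pow] at h
    push_cast at h
    linarith
  have hlogq1 : 1 ≤ Real.log q := by
    have := Real.log_two_gt_d9
    nlinarith
  have hlogq0 : 0 ≤ Real.log q := by linarith
  -- the choice of `M`
  set L : ℝ := (κ * Real.log q + |Real.log c₀|) / (6 / 1000) + A with hL
  have hL0 : 0 ≤ L := by
    have : 0 ≤ (κ * Real.log q + |Real.log c₀|) / (6 / 1000) := by positivity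
    linarith
  set M : ℝ := Real.exp L with hMdef
  have hMpos : 0 < M := Real.exp_pos L
  have hlogM : Real.log M = L := Real.log_exp L
  have hM1 : (n : ℝ) + 1 ≤ M := by
    have h1 : Real.log ((n : ℝ) + 1) ≤ L := by
      have : 0 ≤ 100 * Real.log (4 + ‖ξ‖) :=
        mul_nonneg (by norm_num) (Real.log_nonneg (by linarith [norm_nonneg ξ]))
      have : 0 ≤ (κ * Real.log q + |Real.log c₀|) / (6 / 1000) := by positivity
      linarith
    calc (n : ℝ) + 1 = Real.exp (Real.log ((n : ℝ) + 1)) := (Real.exp_log (by linarith)).symm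
      _ ≤ Real.exp L := Real.exp_le_exp.mpr h1
  have hM2 : (4 + ‖ξ‖) ^ 100 ≤ M := by
    have h4 : 0 < 4 + ‖ξ‖ := by linarith [norm_nonneg ξ]
    have h1 : 100 * Real.log (4 + ‖ξ‖) ≤ L := by
      have : 0 ≤ Real.log ((n : ℝ) + 1) := Real.log_nonneg (by linarith)
      have : 0 ≤ (κ * Real.log q + |Real.log c₀|) / (6 / 1000) := by positivity
      linarith
    calc (4 + ‖ξ‖) ^ 100 = Real.exp (Real.log ((4 + ‖ξ‖) ^ 100)) := (Real.exp_log (by positivity)).symm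
      _ = Real.exp (100 * Real.log (4 + ‖ξ‖)) := by rw [Real.log_pow]; norm_num
      _ ≤ Real.exp L := Real.exp_le_exp.mpr h1
  -- Diaz / Bugeaud 8.11 at ξ = e
  obtain ⟨α, P, hPirr, hPα, hPdeg, hPM, hdist⟩ := Bugeaud2004_thm_8_11_holds ξ n M hn50 hM1 hM2
  clear hM1 hM2
  have hP0 : P ≠ 0 := hPirr.ne_zero
  have hdP : 1 ≤ P.natDegree := by
    rw [Nat.one_le_iff_ne_zero]
    intro h0
    have hc : P = Polynomial.C (P.coeff 0) := eq_C_of_natDegree_eq_zero h0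
    rw [hc, aeval_C, algebraMap_int_eq, eq_intCast, Int.cast_eq_zero] at hPα
    exact hP0 (by rw [hc, hPα, map_zero])
  have hdPR : (1 : ℝ) ≤ P.natDegree := by exact_mod_cast hdP
  set MP : ℝ := (P.map (Int.castRingHom ℂ)).mahlerMeasure with hMP
  have hMP1 : 1 ≤ MP := one_le_mahlerMeasure_map P hP0
  have hMPpos : 0 < MP := by linarith
  have hlogMP0 : 0 ≤ Real.log MP := Real.log_nonneg hMP1
  have hlogMPM : Real.log MP ≤ Real.log M := Real.log_le_log hMPpos hPM
  -- the height `H := H(P)`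
  set H : ℕ := natHeight P with hHdef
  have hH1 : 1 ≤ H := one_le_natHeight P hP0
  have hH1R : (1 : ℝ) ≤ H := by exact_mod_cast hH1
  have hHpos : (0 : ℝ) < H := by linarith
  have hcoef : ∀ j, |P.coeff j| ≤ (H : ℤ) := fun j => abs_coeff_le_natHeight P j
  -- `log H ≤ n log 2 + log M(P)`
  have hlogH : Real.log H ≤ n * Real.log 2 + Real.log MP := by
    have hHle : (H : ℝ) ≤ 2 ^ n * MP :=
      calc (H : ℝ) ≤ 2 ^ P.natDegree * MP := natHeight_le P
        _ ≤ 2 ^ n * MP := by gcongr; norm_num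
    calc Real.log H ≤ Real.log (2 ^ n * MP) := Real.log_le_log hHpos hHle
      _ = n * Real.log 2 + Real.log MP := by
        rw [Real.log_mul (by positivity) hMPpos.ne', Real.log_pow]
  -- the measure at degree `n`: `c₀ H^{-κ} ≤ |e - α|`
  have hmeasP : c₀ * (H : ℝ) ^ (-κ) ≤ ‖ξ - α‖ := hM α P H hP0 hPα hPdeg hH1 hcoef
  -- quality (Q1): `|e - α| ≤ exp(-0.006 L)`
  have hE : 6 / 1000 * Real.log M ≤
      6 / 1000 * ((n : ℝ) * Real.log MP + (P.natDegree : ℝ) * Real.log M) := by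
    have h1 : 0 ≤ (n : ℝ) * Real.log MP := by positivity
    have h2 : Real.log M ≤ (P.natDegree : ℝ) * Real.log M :=
      le_mul_of_one_le_left (hlogM ▸ hL0) hdPR
    linarith
  have hQ1 : ‖ξ - α‖ ≤ Real.exp (-(6 / 1000 * L)) := by
    refine hdist.trans ?_
    rw [Real.exp_le_exp, ← hlogM]
    linarith
  -- hence `κ log q ≤ κ log H`, i.e. `q ≤ H`
  have hlogqH : Real.log q ≤ Real.log H := by
    have h1 : c₀ * (H : ℝ) ^ (-κ) ≤ Real.exp (-(6 / 1000 * L)) := hmeasP.trans hQ1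
    have hpos : 0 < c₀ * (H : ℝ) ^ (-κ) := mul_pos hc₀ (Real.rpow_pos_of_pos hHpos _)
    have h2 := Real.log_le_log hpos h1
    rw [Real.log_mul hc₀.ne' (Real.rpow_pos_of_pos hHpos _).ne', Real.log_rpow hHpos,
      Real.log_exp] at h2
    -- `h2 : log c₀ + (-κ) * log H ≤ -(6/1000 * L)`
    have hL' : 6 / 1000 * L = κ * Real.log q + |Real.log c₀| + 6 / 1000 * A := by
      rw [hL, mul_add, mul_div_cancel₀ _ (by norm_num : (6 / 1000 : ℝ) ≠ 0)]
    rw [hL'] at h2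
    have habs : -|Real.log c₀| ≤ Real.log c₀ := neg_abs_le _
    have hA' : 0 ≤ 6 / 1000 * A := by positivity
    have h3 : κ * Real.log q ≤ κ * Real.log H := by linarith
    exact le_of_mul_le_mul_left h3 hκ
  have hqH : q ≤ H := by
    have h : (q : ℝ) ≤ H := (Real.log_le_log_iff hqpos hHpos).mp hlogqH
    exact_mod_cast h
  -- upper bound `log H ≤ M₀ log q`
  have hHup : (H : ℝ) ≤ (q : ℝ) ^ M₀ := by
    have h1 : Real.log H ≤ n * Real.log 2 + L := by linarith [hlogH, hlogMPM, hlogM]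
    have h2 : n * Real.log 2 + L ≤ M₀ * Real.log q := by
      have e1 : (n : ℝ) * Real.log 2 ≤ (n : ℝ) * Real.log 2 * Real.log q :=
        le_mul_of_one_le_right (by positivity) hlogq1
      have e2 : |Real.log c₀| / (6 / 1000) ≤ |Real.log c₀| / (6 / 1000) * Real.log q :=
        le_mul_of_one_le_right (by positivity) hlogq1
      have e3 : A ≤ A * Real.log q := le_mul_of_one_le_right hA0 hlogq1
      have hLexp : L = κ / (6 / 1000) * Real.log q + |Real.log c₀| / (6 / 1000) + A := by
        rw [hL]; ring
      have hM₀exp : M₀ * Real.log q = (n : ℝ) * Real.log 2 * Real.log q +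
          κ / (6 / 1000) * Real.log q + |Real.log c₀| / (6 / 1000) * Real.log q +
          A * Real.log q + Real.log q := by
        rw [hM₀]; ring
      rw [hLexp, hM₀exp]
      linarith
    calc (H : ℝ) = Real.exp (Real.log H) := (Real.exp_log hHpos).symm
      _ ≤ Real.exp (M₀ * Real.log q) := Real.exp_le_exp.mpr (h1.trans h2)
      _ = (q : ℝ) ^ M₀ := by rw [Real.rpow_def_of_pos hqpos, mul_comm]
  -- quality (Q2): `|e - α| ≤ H^{-n/200}`
  have hQ2 : ‖ξ - α‖ ≤ (H : ℝ) ^ (-((n : ℝ) / 200)) := by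
    refine hdist.trans ?_
    rw [Real.rpow_def_of_pos hHpos, Real.exp_le_exp]
    have hlogH6 : 6 * ((n : ℝ) + 1) * Real.log 2 ≤ Real.log H := hlogq.trans hlogqH
    have hMP' : Real.log H - n * Real.log 2 ≤ Real.log MP := by linarith
    have key := syncDiaz_exponent n (Real.log H) (Real.log MP) (Real.log M) P.natDegree hlogH6 hMP'
      hlogMPM (hlogM ▸ hL0) hdPR
    linarith
  exact ⟨α, P, H, hP0, hPα, hPdeg, hcoef, hqH, hHup, hQ2⟩

end Summit.Schanuel.Schanuel.Cruxes.KhovanskiiApproxTypeEv.LambertLiouvilleKill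

end
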